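import Summits.ValiantsHypothesis.ValiantsHypothesis.Theorems.BarrierLeverAnchoredDoorHitsLowerPairsStarOneCentre

/-!
# Route BarrierLever — support item `AnchoredDoorHitsLowerPairs` (stmt-ValiantsHypothesis-22510), line `anchored_peeling`:
# VERTEX-RICH LOWER PAIRS, I: the split of the vertex classes and the matching column permutation

Helper file (`--supports stmt-ValiantsHypothesis-22510`; val-np-p1 g34), preliminaries of …StarVertexRich (every vertex-rich
injective lower pair is STAR-GOOD). Closes NO item; nothing here bears on crux 14610 or on `VP ≠ VNP`, which is NOT proved.

CONTENT. (§1) One-centre entries on vertex rows / columns in index form (no choice of the vertex of a singleton face).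
(§2) The symbolic weights of the block specialisation: column-leaf variables `d̄ b e`, EDGE variables `c̄ b e` on a block
`R₀v × K₀v` (zero elsewhere), `ḡ = c̄ − d̄`. (§3) `VRSplit u w`: a split of the vertex rows into `R₀ ⊔ R₁` and of the vertex
columns into `K₀ ⊔ K₁` with `|R₁| =` #column faces of size `≥ 2`, `|K₁| =` #row faces of size `≥ 2`, `|R₀| = |K₀|`, one empty face on
each side; it EXISTS exactly on vertex-rich injective lower pairs (`exists_vrSplit`). (§4) The class maps `rt` (rows:
faces `≥ 2` ↦ 0, `R₀` ↦ 1, `R₁` ↦ 2, `∅` ↦ 3) and `ct` (columns: `K₁` ↦ 0, `K₀` ↦ 1, faces `≥ 2` ↦ 2, `∅` ↦ 3) have fibres of equal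
size, whence a column permutation `κ` with `ct (κ j) = rt j` (`Equiv.ofFiberEquiv`).
-/

set_option linter.dupNamespace false

namespace Summit.ValiantsHypothesis.ValiantsHypothesis.Theorems.BarrierLever.AnchoredPeeling

open Finset MvPolynomial

noncomputable section

namespace StarDoor

variable {K : Type*} [CommRing K] {h : ℕ}

/-! ## 1. One-centre entries on vertex rows / columns, in index form -/

section IndexForm

variable (gb db : Fin h → Fin h → K)

/-- A face of size one containing `b` is `{b}`. -/
theorem eq_singleton_of_card_one {A : Finset (Fin h)} (hA : A.card = 1) {b : Fin h} (hb : b ∈ A) : A = {b} := by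
  obtain ⟨x, rfl⟩ := Finset.card_eq_one.mp hA
  rw [Finset.mem_singleton.mp hb]

/-- Vertex row against vertex column: the edge, either orientation. -/
theorem oneTop_card_one_card_one {A S : Finset (Fin h)} (hA : A.card = 1) (hS : S.card = 1) :
    oneTop gb db A S = ∑ b ∈ A, ∑ e ∈ S, (db b e + gb b e) := by
  obtain ⟨b, rfl⟩ := Finset.card_eq_one.mp hA
  obtain ⟨e, rfl⟩ := Finset.card_eq_one.mp hS
  rw [Finset.sum_singleton, Finset.sum_singleton, oneTop_singleton_singleton]

/-- Vertex row against a column face of size `≥ 2`: the star centred at the row vertex. -/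
theorem oneTop_card_one_left {A S : Finset (Fin h)} (hA : A.card = 1) (hS : 2 ≤ S.card) :
    oneTop gb db A S = ∏ b ∈ A, ∏ e ∈ S, db b e := by
  obtain ⟨b, rfl⟩ := Finset.card_eq_one.mp hA
  rw [Finset.prod_singleton, oneTop_singleton_left gb db hS]

/-- Row face of size `≥ 2` against a vertex column: the star centred at the column vertex. -/
theorem oneTop_card_one_right {A S : Finset (Fin h)} (hA : 2 ≤ A.card) (hS : S.card = 1) :
    oneTop gb db A S = ∏ e ∈ S, ∏ b ∈ A, gb b e := by
  obtain ⟨e, rfl⟩ := Finset.card_eq_one.mp hS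
  rw [Finset.prod_singleton, oneTop_singleton_right gb db hA]

end IndexForm

/-! ## 2. The symbolic weights of the block specialisation -/

section Symbolic

/-- Parameters: edge variables `c̄` (left summand) and column-leaf variables `d̄` (right summand), by (row vertex, column vertex). -/
abbrev VRVars (h : ℕ) := (Fin h × Fin h) ⊕ (Fin h × Fin h)

/-- Symbolic column-leaf weights `d̄ b e`. -/
def dSym (b e : Fin h) : MvPolynomial (VRVars h) ℂ := X (Sum.inr (b, e))

/-- Symbolic EDGE weights `c̄ b e = ḡ b e + d̄ b e`: a fresh variable on `R₀v × K₀v`, zero elsewhere (no two-vertex star there). -/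
def cSym (R0v K0v : Finset (Fin h)) (b e : Fin h) : MvPolynomial (VRVars h) ℂ :=
  if b ∈ R0v ∧ e ∈ K0v then X (Sum.inl (b, e)) else 0

/-- Symbolic row-leaf weights `ḡ = c̄ − d̄`. -/
def gSym (R0v K0v : Finset (Fin h)) (b e : Fin h) : MvPolynomial (VRVars h) ℂ := cSym R0v K0v b e - dSym b e

/-- Edge weight: `d̄ + ḡ = c̄`. -/
theorem dSym_add_gSym (R0v K0v : Finset (Fin h)) (b e : Fin h) : dSym b e + gSym R0v K0v b e = cSym R0v K0v b e := by
  unfold gSym; ring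

/-- No edge variable outside the block (row vertex outside `R₀v`). -/
theorem cSym_eq_zero_left {R0v K0v : Finset (Fin h)} {b : Fin h} (hb : b ∉ R0v) (e : Fin h) : cSym R0v K0v b e = 0 := by
  unfold cSym; rw [if_neg (fun h' => hb h'.1)]

/-- No edge variable outside the block (column vertex outside `K₀v`). -/
theorem cSym_eq_zero_right {R0v K0v : Finset (Fin h)} (b : Fin h) {e : Fin h} (he : e ∉ K0v) : cSym R0v K0v b e = 0 := by
  unfold cSym; rw [if_neg (fun h' => he h'.2)]

/-- Inside the block the edge weight is the variable. -/
theorem cSym_of_mem {R0v K0v : Finset (Fin h)} {b e : Fin h} (hb : b ∈ R0v) (he : e ∈ K0v) :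
    cSym R0v K0v b e = X (Sum.inl (b, e)) := by
  unfold cSym; rw [if_pos ⟨hb, he⟩]

end Symbolic

/-! ## 3. The split of the vertex classes -/

section Split

variable {r : ℕ} (u w : Fin r → Finset (Fin h))

/-- **A vertex-rich split.** Vertex rows `R₀ ⊔ R₁`, vertex columns `K₀ ⊔ K₁`, with `|R₁| =` #column faces of size `≥ 2`,
`|K₁| =` #row faces of size `≥ 2`, `|R₀| = |K₀|`, and exactly one empty face on each side. -/
structure VRSplit where
  /-- vertex rows paired with vertex columns -/
  R0 : Finset (Fin r)
  /-- vertex rows paired with the column faces of size `≥ 2` -/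
  R1 : Finset (Fin r)
  /-- vertex columns paired with vertex rows -/
  K0 : Finset (Fin r)
  /-- vertex columns paired with the row faces of size `≥ 2` -/
  K1 : Finset (Fin r)
  card_R0 : ∀ i ∈ R0, (u i).card = 1
  card_R1 : ∀ i ∈ R1, (u i).card = 1
  disj_R : ∀ i ∈ R0, i ∉ R1
  cover_R : ∀ i, (u i).card = 1 → i ∉ R1 → i ∈ R0
  card_K0 : ∀ j ∈ K0, (w j).card = 1
  card_K1 : ∀ j ∈ K1, (w j).card = 1
  disj_K : ∀ j ∈ K0, j ∉ K1
  cover_K : ∀ j, (w j).card = 1 → j ∉ K1 → j ∈ K0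
  hR1 : R1.card = (univ.filter fun j => 2 ≤ (w j).card).card
  hK1 : K1.card = (univ.filter fun i => 2 ≤ (u i).card).card
  hRK : R0.card = K0.card
  hZr : (univ.filter fun i => (u i).card = 0).card = 1
  hZc : (univ.filter fun j => (w j).card = 0).card = 1

/-- The faces of an injective family split by size `0 / 1 / ≥ 2`. -/
theorem card_classes (v : Fin r → Finset (Fin h)) :
    (univ.filter fun i => (v i).card = 0).card + (univ.filter fun i => (v i).card = 1).card +
      (univ.filter fun i => 2 ≤ (v i).card).card = r := by
  classical
  have h1 : (univ.filter fun i => (v i).card = 0).card + (univ.filter fun i => ¬ (v i).card = 0).card = r := by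
    rw [Finset.card_filter_add_card_filter_not, Finset.card_univ, Fintype.card_fin]
  have h2 := Finset.card_filter_add_card_filter_not
    (s := (univ : Finset (Fin r)).filter (fun i => ¬ (v i).card = 0)) (fun i => (v i).card = 1)
  rw [Finset.filter_filter, Finset.filter_filter] at h2
  have hV : (univ.filter fun i => ¬(v i).card = 0 ∧ (v i).card = 1) = univ.filter fun i => (v i).card = 1 := by
    ext i; simp only [Finset.mem_filter, Finset.mem_univ, true_and]; omega
  have hB : (univ.filter fun i => ¬(v i).card = 0 ∧ ¬(v i).card = 1) = univ.filter fun i => 2 ≤ (v i).card := by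
    ext i; simp only [Finset.mem_filter, Finset.mem_univ, true_and]; omega
  rw [hV, hB] at h2
  omega

/-- An injective lower family of `r ≥ 1` faces contains exactly one empty face. -/
theorem card_filter_empty_eq_one (v : Fin r → Finset (Fin h)) (hv : Function.Injective v) (hlv : IsLowerSet (Set.range v))
    (hr : 0 < r) : (univ.filter fun i => (v i).card = 0).card = 1 := by
  obtain ⟨i₀, hi₀⟩ : ∅ ∈ Set.range v := hlv (bot_le : (∅ : Finset (Fin h)) ≤ v ⟨0, hr⟩) ⟨_, rfl⟩
  have : (univ.filter fun i => (v i).card = 0) = {i₀} := by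
    ext i
    simp only [Finset.mem_filter, Finset.mem_univ, true_and, Finset.mem_singleton, Finset.card_eq_zero]
    constructor
    · intro hi; exact hv (hi.trans hi₀.symm)
    · rintro rfl; exact hi₀
  rw [this, Finset.card_singleton]

/-- **A vertex-rich injective lower pair admits a split.** -/
theorem exists_vrSplit (hu : Function.Injective u) (hw : Function.Injective w)
    (hlu : IsLowerSet (Set.range u)) (hlw : IsLowerSet (Set.range w)) (hr : 0 < r)
    (hrich : r ≤ (univ.filter fun i => (u i).card = 1).card + (univ.filter fun j => (w j).card = 1).card + 1) :
    Nonempty (VRSplit u w) := by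
  classical
  have hcu := card_classes u
  have hcw := card_classes w
  have hZr := card_filter_empty_eq_one u hu hlu hr
  have hZc := card_filter_empty_eq_one w hw hlw hr
  have hBrVc : (univ.filter fun i => 2 ≤ (u i).card).card ≤ (univ.filter fun j => (w j).card = 1).card := by omega
  have hBcVr : (univ.filter fun j => 2 ≤ (w j).card).card ≤ (univ.filter fun i => (u i).card = 1).card := by omega
  obtain ⟨K1, hK1V, hK1c⟩ := Finset.exists_subset_card_eq hBrVc
  obtain ⟨R1, hR1V, hR1c⟩ := Finset.exists_subset_card_eq hBcVr
  refine ⟨{ R0 := (univ.filter fun i => (u i).card = 1) \ R1, R1 := R1,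
            K0 := (univ.filter fun j => (w j).card = 1) \ K1, K1 := K1,
            card_R0 := ?_, card_R1 := ?_, disj_R := ?_, cover_R := ?_,
            card_K0 := ?_, card_K1 := ?_, disj_K := ?_, cover_K := ?_,
            hR1 := hR1c, hK1 := hK1c, hRK := ?_, hZr := hZr, hZc := hZc }⟩
  · intro i hi; exact (Finset.mem_filter.mp (Finset.mem_sdiff.mp hi).1).2
  · intro i hi; exact (Finset.mem_filter.mp (hR1V hi)).2
  · intro i hi; exact (Finset.mem_sdiff.mp hi).2
  · intro i hi hiR1; exact Finset.mem_sdiff.mpr ⟨Finset.mem_filter.mpr ⟨Finset.mem_univ _, hi⟩, hiR1⟩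
  · intro j hj; exact (Finset.mem_filter.mp (Finset.mem_sdiff.mp hj).1).2
  · intro j hj; exact (Finset.mem_filter.mp (hK1V hj)).2
  · intro j hj; exact (Finset.mem_sdiff.mp hj).2
  · intro j hj hjK1; exact Finset.mem_sdiff.mpr ⟨Finset.mem_filter.mpr ⟨Finset.mem_univ _, hj⟩, hjK1⟩
  · rw [Finset.card_sdiff_of_subset hR1V, Finset.card_sdiff_of_subset hK1V]
    omega

end Split

/-! ## 4. The class maps and the matching column permutation -/

namespace VRSplit

variable {r : ℕ} {u w : Fin r → Finset (Fin h)} (S : VRSplit u w)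

/-- Row classes: faces of size `≥ 2` ↦ 0, `R₀` ↦ 1, `R₁` ↦ 2, the empty face ↦ 3 (the block order, see …StarVertexRich). -/
def rt (i : Fin r) : ℕ := if i ∈ S.R0 then 1 else if i ∈ S.R1 then 2 else if 2 ≤ (u i).card then 0 else 3

/-- Column classes, numbered by their partner row class: `K₁` ↦ 0, `K₀` ↦ 1, faces of size `≥ 2` ↦ 2, the empty face ↦ 3. -/
def ct (j : Fin r) : ℕ := if j ∈ S.K0 then 1 else if 2 ≤ (w j).card then 2 else if j ∈ S.K1 then 0 else 3

/-- Row class `1` = `R₀`. -/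
theorem rt_eq_one_iff (i : Fin r) : S.rt i = 1 ↔ i ∈ S.R0 := by
  unfold rt
  by_cases h0 : i ∈ S.R0
  · simp [h0]
  · by_cases h1 : i ∈ S.R1
    · simp [h0, h1]
    · by_cases h2 : 2 ≤ (u i).card <;> simp [h0, h1, h2]

/-- Row class `2` = `R₁`. -/
theorem rt_eq_two_iff (i : Fin r) : S.rt i = 2 ↔ i ∈ S.R1 := by
  unfold rt
  by_cases h0 : i ∈ S.R0
  · simp [h0, S.disj_R i h0]
  · by_cases h1 : i ∈ S.R1
    · simp [h0, h1]
    · by_cases h2 : 2 ≤ (u i).card <;> simp [h0, h1, h2]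

/-- Row class `0` = the faces of size `≥ 2`. -/
theorem rt_eq_zero_iff (i : Fin r) : S.rt i = 0 ↔ 2 ≤ (u i).card := by
  unfold rt
  by_cases h0 : i ∈ S.R0
  · have := S.card_R0 i h0; simp [h0]; omega
  · by_cases h1 : i ∈ S.R1
    · have := S.card_R1 i h1; simp [h0, h1]; omega
    · by_cases h2 : 2 ≤ (u i).card <;> simp [h0, h1, h2]

/-- Row classes are `≤ 3`. -/
theorem rt_le_three (i : Fin r) : S.rt i ≤ 3 := by
  unfold rt; split_ifs <;> omega

/-- Row class `3` = the empty face. -/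
theorem rt_eq_three_iff (i : Fin r) : S.rt i = 3 ↔ (u i).card = 0 := by
  have h3 := S.rt_le_three i
  have e0 := S.rt_eq_zero_iff i
  have e1 := S.rt_eq_one_iff i
  have e2 := S.rt_eq_two_iff i
  constructor
  · intro h
    by_contra hne
    by_cases hc : 2 ≤ (u i).card
    · have := e0.mpr hc; omega
    · have hi : i ∈ S.R0 := S.cover_R i (by omega) (fun h1 => by have := e2.mpr h1; omega)
      have := e1.mpr hi; omega
  · intro h
    have n0 : ¬ S.rt i = 0 := fun h0 => by have := e0.mp h0; omega
    have n1 : ¬ S.rt i = 1 := fun h1 => by have := S.card_R0 i (e1.mp h1); omega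
    have n2 : ¬ S.rt i = 2 := fun h2 => by have := S.card_R1 i (e2.mp h2); omega
    omega

/-- Column class `1` = `K₀`. -/
theorem ct_eq_one_iff (j : Fin r) : S.ct j = 1 ↔ j ∈ S.K0 := by
  unfold ct
  by_cases h0 : j ∈ S.K0
  · simp [h0]
  · by_cases h2 : 2 ≤ (w j).card
    · simp [h0, h2]
    · by_cases h1 : j ∈ S.K1 <;> simp [h0, h1, h2]

/-- Column class `2` = the faces of size `≥ 2`. -/
theorem ct_eq_two_iff (j : Fin r) : S.ct j = 2 ↔ 2 ≤ (w j).card := by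
  unfold ct
  by_cases h0 : j ∈ S.K0
  · have := S.card_K0 j h0; simp [h0]; omega
  · by_cases h2 : 2 ≤ (w j).card
    · simp [h0, h2]
    · by_cases h1 : j ∈ S.K1 <;> simp [h0, h1, h2]

/-- Column class `0` = `K₁`. -/
theorem ct_eq_zero_iff (j : Fin r) : S.ct j = 0 ↔ j ∈ S.K1 := by
  unfold ct
  by_cases h0 : j ∈ S.K0
  · simp [h0, S.disj_K j h0]
  · by_cases h2 : 2 ≤ (w j).card
    · have h1 : j ∉ S.K1 := fun h1 => by have := S.card_K1 j h1; omega
      simp [h0, h1, h2]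
    · by_cases h1 : j ∈ S.K1 <;> simp [h0, h1, h2]

/-- Column classes are `≤ 3`. -/
theorem ct_le_three (j : Fin r) : S.ct j ≤ 3 := by
  unfold ct; split_ifs <;> omega

/-- Column class `3` = the empty face. -/
theorem ct_eq_three_iff (j : Fin r) : S.ct j = 3 ↔ (w j).card = 0 := by
  have h3 := S.ct_le_three j
  have e0 := S.ct_eq_zero_iff j
  have e1 := S.ct_eq_one_iff j
  have e2 := S.ct_eq_two_iff j
  constructor
  · intro h
    by_contra hne
    by_cases hc : 2 ≤ (w j).card
    · have := e2.mpr hc; omega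
    · have hj : j ∈ S.K0 := S.cover_K j (by omega) (fun h1 => by have := e0.mpr h1; omega)
      have := e1.mpr hj; omega
  · intro h
    have n0 : ¬ S.ct j = 0 := fun h0 => by have := S.card_K1 j (e0.mp h0); omega
    have n1 : ¬ S.ct j = 1 := fun h1 => by have := S.card_K0 j (e1.mp h1); omega
    have n2 : ¬ S.ct j = 2 := fun h2 => by have := e2.mp h2; omega
    omega

/-- A filter described by an `iff` is the named set. -/
theorem filter_eq_of_iff (p : Fin r → Prop) [DecidablePred p] (T : Finset (Fin r)) (hp : ∀ i, p i ↔ i ∈ T) :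
    (univ.filter p) = T := by
  ext i; simp [hp i]

/-- **The fibres of the two class maps have equal sizes.** -/
theorem card_fiber_eq (k : ℕ) : (univ.filter fun i => S.rt i = k).card = (univ.filter fun j => S.ct j = k).card := by
  classical
  rcases Nat.lt_or_ge k 4 with hk | hk
  · interval_cases k
    · rw [filter_eq_of_iff _ S.K1 S.ct_eq_zero_iff, S.hK1]
      congr 1; ext i; simp [S.rt_eq_zero_iff]
    · rw [filter_eq_of_iff _ S.R0 S.rt_eq_one_iff, filter_eq_of_iff _ S.K0 S.ct_eq_one_iff, S.hRK]
    · rw [filter_eq_of_iff _ S.R1 S.rt_eq_two_iff, S.hR1]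
      congr 1; ext j; simp [S.ct_eq_two_iff]
    · have h1 : (univ.filter fun i => S.rt i = 3) = univ.filter fun i => (u i).card = 0 := by
        ext i; simp [S.rt_eq_three_iff]
      have h2 : (univ.filter fun j => S.ct j = 3) = univ.filter fun j => (w j).card = 0 := by
        ext j; simp [S.ct_eq_three_iff]
      rw [h1, h2, S.hZr, S.hZc]
  · rw [filter_eq_of_iff _ ∅ (fun i => by simp; have := S.rt_le_three i; omega),
      filter_eq_of_iff _ ∅ (fun j => by simp; have := S.ct_le_three j; omega)]

/-- The fibres of the two class maps have equal sizes (subtype form). -/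
theorem card_subtype_fiber_eq (k : ℕ) : Fintype.card {i // S.rt i = k} = Fintype.card {j // S.ct j = k} := by
  classical
  rw [Fintype.card_subtype, Fintype.card_subtype]; exact S.card_fiber_eq k

/-- **The column permutation matching the classes:** `ct (κ j) = rt j`. -/
def κ : Fin r ≃ Fin r := Equiv.ofFiberEquiv (f := S.rt) (g := S.ct) fun k => Fintype.equivOfCardEq (S.card_subtype_fiber_eq k)

/-- The column permutation matches the classes: `ct (κ j) = rt j`. -/
theorem ct_κ (j : Fin r) : S.ct (S.κ j) = S.rt j := Equiv.ofFiberEquiv_map _ j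

/-- The class-3 fibre (the empty row) is a subsingleton. -/
theorem subsingleton_fiber_three : Subsingleton {i // S.rt i = 3} := by
  classical
  refine Fintype.card_le_one_iff_subsingleton.mp ?_
  rw [Fintype.card_subtype]
  have h1 : (univ.filter fun i => S.rt i = 3) = univ.filter fun i => (u i).card = 0 := by
    ext i; simp [S.rt_eq_three_iff]
  rw [h1, S.hZr]

/-! ### The vertex sets of the block -/

/-- The vertices of the rows in `R₀`. -/
def R0v : Finset (Fin h) := S.R0.biUnion u

/-- The vertices of the columns in `K₀`. -/
def K0v : Finset (Fin h) := S.K0.biUnion w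

/-- The vertex of a row in `R₀` lies in `R₀v`. -/
theorem mem_R0v {i : Fin r} (hi : i ∈ S.R0) {b : Fin h} (hb : b ∈ u i) : b ∈ S.R0v := by
  unfold R0v; rw [Finset.mem_biUnion]; exact ⟨i, hi, hb⟩

/-- The vertex of a column in `K₀` lies in `K₀v`. -/
theorem mem_K0v {j : Fin r} (hj : j ∈ S.K0) {e : Fin h} (he : e ∈ w j) : e ∈ S.K0v := by
  unfold K0v; rw [Finset.mem_biUnion]; exact ⟨j, hj, he⟩

/-- A vertex row outside `R₀` has its vertex outside `R₀v` (injectivity of `u`). -/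
theorem not_mem_R0v (hu : Function.Injective u) {i : Fin r} (hi : (u i).card = 1) (hiR0 : i ∉ S.R0) {b : Fin h}
    (hb : b ∈ u i) : b ∉ S.R0v := by
  intro hbv
  unfold R0v at hbv
  rw [Finset.mem_biUnion] at hbv
  obtain ⟨i', hi'R0, hbi'⟩ := hbv
  have h1 : u i' = {b} := eq_singleton_of_card_one (S.card_R0 i' hi'R0) hbi'
  have h2 : u i = {b} := eq_singleton_of_card_one hi hb
  exact hiR0 (hu (h2.trans h1.symm) ▸ hi'R0)

/-- A vertex column outside `K₀` has its vertex outside `K₀v` (injectivity of `w`). -/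
theorem not_mem_K0v (hw : Function.Injective w) {j : Fin r} (hj : (w j).card = 1) (hjK0 : j ∉ S.K0) {e : Fin h}
    (he : e ∈ w j) : e ∉ S.K0v := by
  intro hev
  unfold K0v at hev
  rw [Finset.mem_biUnion] at hev
  obtain ⟨j', hj'K0, hej'⟩ := hev
  have h1 : w j' = {e} := eq_singleton_of_card_one (S.card_K0 j' hj'K0) hej'
  have h2 : w j = {e} := eq_singleton_of_card_one hj he
  exact hjK0 (hw (h2.trans h1.symm) ▸ hj'K0)

end VRSplit

end StarDoor

end

end Summit.ValiantsHypothesis.ValiantsHypothesis.Theorems.BarrierLever.AnchoredPeeling
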